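import Mathlib
import Summits.ValiantsHypothesis.ValiantsHypothesis.Theses.ProjectionRigidity
import Summits.ValiantsHypothesis.ValiantsHypothesis.Theorems.ProjectionRigidityProjLaplaceDoublingContent
import Literature.Computability.AlgebraicComplexity.GrenetProjection
import Literature.Computability.AlgebraicComplexity.DetReprEquivalent
import Literature.Computability.AlgebraicComplexity.StandardFamiliesProofs
import Literature.Computability.AlgebraicComplexity.RankOneDeterminantalExpressionsProofs

/-!
# Disproof of `ProjLaplaceDoubling` (stmt-ValiantsHypothesis-16002) — standing disprover's work file

Crux (verbatim): `C := ProjOptimalUnique → ∀ n ≥ 3, 2ⁿ − 1 ≤ pdc(per_n) → 2ⁿ⁺¹ − 1 ≤ pdc(per_{n+1})`,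
`pdc = detProjectionComplexity` (Valiant projections: every cell a variable or a constant).

## Findings (index; cycle 1, refuter-cdisprove-stmt-ValiantsHypothesis-16002-0, 2026-08-17)

1. **STRUCTURE — the crux IS "uniqueness ⇒ Target".**  `C ↔ (ProjOptimalUnique → Target)` (tree:
   `projLaplaceDoubling_iff`, lead's `Theorems/ProjectionRigidityProjLaplaceDoublingContent.lean`, first found by
   the rattack seat).  Hence `¬C ↔ ProjOptimalUnique ∧ ¬Target`: an UNCONDITIONAL kill needs a PROOF of
   `ProjOptimalUnique` (all `n ≥ 3`) plus a sub-Grenet projection of some `per_{n+1}` — C is unfalsifiable today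
   (§1 below re-derives the dichotomy `C ↔ (¬ProjOptimalUnique ∨ Target)`).
2. **LOAD-BEARING ANALYSIS.**  (a) Drop `ProjOptimalUnique`: `CWithoutUnique ↔ Target` (§2, proved) — the
   hypothesis carries ALL the weight; "doubling" as an implication between the numbers `pdc(per_n)` is no weaker
   than Target (base `pdc(per₃) = 7` in tree).  (b) Drop `n ≥ 3`: harmless for the doubling numbers
   (`pdc(per₁,₂,₃) = 1, 3, 7`, rattack note) but NOT for the hypothesis: `ProjOptimalUnique`'s own guard `n ≥ 3`
   is load-bearing — at `n = 2` the optimal (`3 × 3`) projections of `per₂` form ≥ 2 orbits (Grenet₂ has a constant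
   part of rank 2, the Schur lift of the signed `2 × 2` determinant `[[X00,0,X10],[X01,X11,0],[0,1,1]]` rank 1):
   Lean `projOptimalUnique_false_at_two` (`Negative/SmallN.lean`, p152207).  (c) Drop the projection model (affine
   `dc`): the doubling pattern fails at `n = 1` (`dc(per₂) ≤ 2 < 3`, Lean `affineDoubling_false_from_one`, same file),
   holds in the projection model (`pdc(per₂) = 3`, tree `PdcQpOfVp.Negative.detProjectionComplexity_perPoly_two`):
   the sign obstruction is what makes doubling start at all; and uniqueness is NOT necessary for the doubling
   `3 → 7` one level down.
3. **TARGETS — line `birth` (registered, PICKED, declared dead by the lead on paper): stub 1 is FALSE, now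
   kernel-checked and LANDED.**  `stub_windowReduction_false : ¬(registered stub 1, verbatim)` at `(n, m) = (3, 8)`:
   §3 below (full proof; the same file is in the tree as `Theorems/ProjLaplaceDoubling/Negative/StubWindowReductionFalse.lean`,
   p150468 ACCEPTED, commit 83e0aa28be8f).  Witness = the row-Laplace `8 × 8` `{0,1,X}` branching program `B8` of `per₃`; mechanism = ROW/COLUMN
   PINS (linear part has ℂ-independent rows and columns) ⇒ a `(0|7|1)` window forces a zero row of `P`, a `(1|7|0)`
   window a zero column of `Q` (corner constant by Laplace + `det core = per₃`).  This is strictly cheaper and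
   strictly smaller than the purified-Koszul witnesses (`m = 10, 11`, module-lattice argument) of `Lines/birth-dead.md`:
   window normal forms fail for cancellation-FREE multilinear ABPs one step above optimal size, as soon as the
   column order varies along paths.  `stub_corePacking`: formally unfalsifiable today (its first hypothesis is
   uniqueness at level `n`; at `n = 3` this is `ProjOptimalUniqueThree`, open) and moot (its window hypothesis can no
   longer be produced by a true reduction lemma).
4. **NATURAL STRENGTHENINGS refuted.**  "Every projection of `per_n` of size `≤ pdc + 1` is a constant-gauge window
   over a `pdc`-core" — false at `n = 3` (§3).  Any re-lining through block normal forms of NON-optimal projections is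
   dead for `{0,1}` designs already; sub-permanent structure must be read WITHOUT a block form (on `adj B` / vertex
   path polynomials) or the restriction class must exclude path-dependent column orders (it does not: restrictions of
   an optimal projection of `per_{n+1}` need not be column-ordered).
5. **THE HYPOTHESIS IS FALSE — C HOLDS VACUOUSLY (decided this cycle, §7).**  The single-syzygy twist `gB₁ = gA(1+D)` IS
   purifiable: `K = P·gB₁·Q` (explicit `P, Q ∈ SL₇(ℤ)`) is a `7 × 7` `{0,±1,X}`-projection of `per₃` outside Grenet's orbit
   (five rank-2 coefficient matrices against three).  Lean: `Theorems.ProjectionRigidityProjOptimalUniqueThree_refuted :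
   ¬ProjOptimalUniqueThree`, `…ProjOptimalUnique_refuted : ¬ProjOptimalUnique` (file compiled rc0, std axioms; helper
   `Theorems/ProjOptimalUnique/Negative/PurifiedTwist.lean` = p154569, refutation file proposed after it).  Hence
   `ProjLaplaceDoubling` is provable in one line by the lead: `projLaplaceDoubling_of_not_projOptimalUniqueThree
   ProjectionRigidityProjOptimalUniqueThree_refuted` — and the route is dead at its rank-2 crux (kill criterion #1).

External exact checks: refuter folder `compute/verify8.py` (Leibniz det, kernel ranks), `compute/anneal8.py` (search).
-/

-- single-conjunct layout: Sub = Summit, duplicated namespace component intended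
set_option linter.dupNamespace false

namespace Summit.ValiantsHypothesis.ValiantsHypothesis.Cruxes.ProjLaplaceDoubling.Disproof

open MvPolynomial Matrix
open Literature.Computability.AlgebraicComplexity
open Summit.ValiantsHypothesis.ValiantsHypothesis.Theses.ProjectionRigidity
open Summit.ValiantsHypothesis.ValiantsHypothesis.Theorems

/-! ## §1 Structure: the crux is a dichotomy `¬ProjOptimalUnique ∨ Target` -/

/-- The crux is equivalent to the classical dichotomy "uniqueness fails or Grenet is optimal for every n ≥ 3"
(from the tree's `projLaplaceDoubling_iff`). Any refutation must therefore PROVE `ProjOptimalUnique`. -/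
theorem projLaplaceDoubling_iff_not_unique_or_target :
    ProjLaplaceDoubling ↔ (¬ ProjOptimalUnique ∨ Target) := by
  rw [projLaplaceDoubling_iff]
  tauto

/-- What an unconditional kill would have to supply. -/
theorem not_projLaplaceDoubling_iff : ¬ ProjLaplaceDoubling ↔ (ProjOptimalUnique ∧ ¬ Target) := by
  rw [projLaplaceDoubling_iff]
  tauto

/-! ## §2 Load-bearing hypothesis: without `ProjOptimalUnique` the crux is exactly `Target` -/

/-- The crux with its only named hypothesis dropped: bare doubling of the numbers `pdc(per_n)`. -/
def ProjLaplaceDoublingWithoutUnique : Prop :=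
  ∀ n ≥ 3, 2 ^ n - 1 ≤ detProjectionComplexity (perPoly (Fin n) ℂ) →
    2 ^ (n + 1) - 1 ≤ detProjectionComplexity (perPoly (Fin (n + 1)) ℂ)

/-- Bare doubling is equivalent to `Target` (anchor `pdc(per₃) = 7`, tree): dropping `ProjOptimalUnique`
leaves exactly the route's target, so `_false_without_Unique` would be `¬Target` — not provable today; the
hypothesis is load-bearing only in the formal sense that it is ALL the crux has to work with. -/
theorem projLaplaceDoublingWithoutUnique_iff_target : ProjLaplaceDoublingWithoutUnique ↔ Target := by
  constructor
  · intro h n hn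
    induction n, hn using Nat.le_induction with
    | base => rw [detProjectionComplexity_perPoly_three]; norm_num
    | succ n hn ih => exact h n hn ih
  · intro h n hn _
    exact h (n + 1) (by omega)

/-- … and the crux is `ProjOptimalUnique → ProjLaplaceDoublingWithoutUnique` on the nose. -/
theorem projLaplaceDoubling_iff_unique_imp_without :
    ProjLaplaceDoubling ↔ (ProjOptimalUnique → ProjLaplaceDoublingWithoutUnique) := Iff.rfl

/-! ## §3 Targets: registered stub 1 of line `birth` is false at `(n, m) = (3, 8)`

Verbatim copy of the proposed `Theorems/ProjLaplaceDoubling/Negative/StubWindowReductionFalse.lean` (p150468), kept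
here so that this work file is self-contained for ideators / planners. -/

set_option maxHeartbeats 1600000 in
/-- **`stub_windowReduction` (line `birth` of crux `ProjLaplaceDoubling`) is false**: at `n = 3`, `m = 8`
the row-Laplace branching program `B8` of `per₃` (an `8 × 8` `{0,1,X}`-projection of `DET₈`) admits no
constant-gauge window `(a | 7 | 1 - a)` with a projection core of determinant `per₃`, because its linear
part has linearly independent rows and columns (pins) while a window forces a zero row of `P`
(`a = 0`) or a zero column of `Q` (`a = 1`). [folklore] -/
theorem stub_windowReduction_false : ¬ (
    ∀ n : ℕ, 3 ≤ n → 2 ^ n - 1 ≤ detProjectionComplexity (perPoly (Fin n) ℂ) →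
    ∀ m : ℕ, m ≤ 2 * detProjectionComplexity (perPoly (Fin n) ℂ) →
      ∀ B : Matrix (Fin m) (Fin m) (MvPolynomial (Fin n × Fin n) ℂ),
        (∀ p q, (∃ v, B p q = MvPolynomial.X v) ∨ ∃ c, B p q = MvPolynomial.C c) →
        B.det = perPoly (Fin n) ℂ →
        ∃ (a : ℕ) (h : a + detProjectionComplexity (perPoly (Fin n) ℂ) ≤ m) (P Q : GL (Fin m) ℂ)
          (B' : Matrix (Fin m) (Fin m) (MvPolynomial (Fin n × Fin n) ℂ)),
          B' = (P : Matrix (Fin m) (Fin m) ℂ).map MvPolynomial.C * B *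
                (Q : Matrix (Fin m) (Fin m) ℂ).map MvPolynomial.C ∧
          (∀ p q : Fin m, a ≤ (p : ℕ) → (q : ℕ) < a → B' p q = 0) ∧
          (∀ p q : Fin m, a + detProjectionComplexity (perPoly (Fin n) ℂ) ≤ (p : ℕ) →
            (q : ℕ) < a + detProjectionComplexity (perPoly (Fin n) ℂ) → B' p q = 0) ∧
          (∀ p q : Fin (detProjectionComplexity (perPoly (Fin n) ℂ)),
            (∃ v, B' (Fin.castLE h (Fin.natAdd a p)) (Fin.castLE h (Fin.natAdd a q)) = MvPolynomial.X v) ∨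
              ∃ c, B' (Fin.castLE h (Fin.natAdd a p)) (Fin.castLE h (Fin.natAdd a q)) = MvPolynomial.C c) ∧
          (B'.submatrix
              (fun p : Fin (detProjectionComplexity (perPoly (Fin n) ℂ)) => Fin.castLE h (Fin.natAdd a p))
              (fun q : Fin (detProjectionComplexity (perPoly (Fin n) ℂ)) => Fin.castLE h (Fin.natAdd a q))).det =
            perPoly (Fin n) ℂ) := by
  intro hW
  have pdc3 : detProjectionComplexity (perPoly (Fin 3) ℂ) = 7 := detProjectionComplexity_perPoly_three
  -- ### the witness and its unipotent factorisation `B8 * E1 = A1`, `A1 * E2 = T`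
  obtain ⟨B, hB⟩ : ∃ M : Matrix (Fin 8) (Fin 8) (MvPolynomial (Fin 3 × Fin 3) ℂ), M =
      !![0, X (2,0), X (2,1), X (2,2), 0, 0, 0, 0;
         0, 1, 0, 0, 0, 0, X (0,1), X (1,1);
         0, 0, 1, 0, X (0,2), X (1,2), 0, 0;
         0, 0, 0, 1, X (0,1), X (1,1), 0, 0;
         X (1,0), 0, 0, 0, 1, 0, 0, 0;
         X (0,0), 0, 0, 0, 0, 1, 0, 0;
         X (1,2), 0, 0, 0, 0, 0, 1, 0;
         X (0,2), 0, 0, 0, 0, 0, 0, 1] := ⟨_, rfl⟩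
  obtain ⟨E1, hE1⟩ : ∃ M : Matrix (Fin 8) (Fin 8) (MvPolynomial (Fin 3 × Fin 3) ℂ), M =
      !![1, 0, 0, 0, 0, 0, 0, 0;
         0, 1, 0, 0, 0, 0, -X (0,1), -X (1,1);
         0, 0, 1, 0, -X (0,2), -X (1,2), 0, 0;
         0, 0, 0, 1, -X (0,1), -X (1,1), 0, 0;
         0, 0, 0, 0, 1, 0, 0, 0;
         0, 0, 0, 0, 0, 1, 0, 0;
         0, 0, 0, 0, 0, 0, 1, 0;
         0, 0, 0, 0, 0, 0, 0, 1] := ⟨_, rfl⟩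
  obtain ⟨E2, hE2⟩ : ∃ M : Matrix (Fin 8) (Fin 8) (MvPolynomial (Fin 3 × Fin 3) ℂ), M =
      !![1, 0, 0, 0, 0, 0, 0, 0;
         0, 1, 0, 0, 0, 0, 0, 0;
         0, 0, 1, 0, 0, 0, 0, 0;
         0, 0, 0, 1, 0, 0, 0, 0;
         -X (1,0), 0, 0, 0, 1, 0, 0, 0;
         -X (0,0), 0, 0, 0, 0, 1, 0, 0;
         -X (1,2), 0, 0, 0, 0, 0, 1, 0;
         -X (0,2), 0, 0, 0, 0, 0, 0, 1] := ⟨_, rfl⟩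
  obtain ⟨A1, hA1⟩ : ∃ M : Matrix (Fin 8) (Fin 8) (MvPolynomial (Fin 3 × Fin 3) ℂ), M =
      !![0, X (2,0), X (2,1), X (2,2), -(X (2,1) * X (0,2) + X (2,2) * X (0,1)),
           -(X (2,1) * X (1,2) + X (2,2) * X (1,1)), -(X (2,0) * X (0,1)), -(X (2,0) * X (1,1));
         0, 1, 0, 0, 0, 0, 0, 0;
         0, 0, 1, 0, 0, 0, 0, 0;
         0, 0, 0, 1, 0, 0, 0, 0;
         X (1,0), 0, 0, 0, 1, 0, 0, 0;
         X (0,0), 0, 0, 0, 0, 1, 0, 0;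
         X (1,2), 0, 0, 0, 0, 0, 1, 0;
         X (0,2), 0, 0, 0, 0, 0, 0, 1] := ⟨_, rfl⟩
  obtain ⟨T, hT⟩ : ∃ M : Matrix (Fin 8) (Fin 8) (MvPolynomial (Fin 3 × Fin 3) ℂ), M =
      !![perPoly (Fin 3) ℂ, X (2,0), X (2,1), X (2,2), -(X (2,1) * X (0,2) + X (2,2) * X (0,1)),
           -(X (2,1) * X (1,2) + X (2,2) * X (1,1)), -(X (2,0) * X (0,1)), -(X (2,0) * X (1,1));
         0, 1, 0, 0, 0, 0, 0, 0;
         0, 0, 1, 0, 0, 0, 0, 0;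
         0, 0, 0, 1, 0, 0, 0, 0;
         0, 0, 0, 0, 1, 0, 0, 0;
         0, 0, 0, 0, 0, 1, 0, 0;
         0, 0, 0, 0, 0, 0, 1, 0;
         0, 0, 0, 0, 0, 0, 0, 1] := ⟨_, rfl⟩
  have p3 : perPoly (Fin 3) ℂ = X (0,0) * (X (1,1) * X (2,2) + X (2,1) * X (1,2))
      + X (1,0) * (X (0,1) * X (2,2) + X (2,1) * X (0,2))
      + X (2,0) * (X (0,1) * X (1,2) + X (1,1) * X (0,2)) := by
    simp [perPoly, permanent_fin_three, Matrix.mvPolynomialX_apply]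
  have coeff_one_single : ∀ v : Fin 3 × Fin 3,
      (1 : MvPolynomial (Fin 3 × Fin 3) ℂ).coeff (Finsupp.single v 1) = 0 := fun v => by
    rw [MvPolynomial.coeff_one, if_neg]
    exact Ne.symm (Finsupp.single_ne_zero.mpr one_ne_zero)
  -- ### ONE inspection of the 64 cells: the two products, triangularity, and the shape of the cells
  have big : ∀ i j : Fin 8,
      ((B * E1) i j = A1 i j ∧ (A1 * E2) i j = T i j) ∧
      ((j < i → E1 i j = 0) ∧ (j < i → T i j = 0) ∧ (i < j → E2 i j = 0)) ∧
      (B i j = 0 ∨ B i j = 1 ∨ ∃ w, B i j = X w) := by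
    intro i j
    rw [hB, hE1, hE2, hA1, hT, p3]
    fin_cases i <;> fin_cases j <;> refine ⟨⟨?_, ?_⟩, ⟨?_, ?_, ?_⟩, ?_⟩ <;>
      simp [Matrix.mul_apply, Fin.sum_univ_eight]
    all_goals ring
  -- ### `B8` is a projection matrix with `det B8 = per₃`
  have hproj : ∀ p q : Fin 8, (∃ v, B p q = MvPolynomial.X v) ∨ ∃ c, B p q = MvPolynomial.C c := by
    intro p q
    rcases (big p q).2.2 with h | h | ⟨w, h⟩
    · exact Or.inr ⟨0, by rw [h, map_zero]⟩
    · exact Or.inr ⟨1, by rw [h, map_one]⟩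
    · exact Or.inl ⟨w, h⟩
  have hdet : B.det = perPoly (Fin 3) ℂ := by
    have h1 : B * E1 = A1 := Matrix.ext fun i j => (big i j).1.1
    have h2 : A1 * E2 = T := Matrix.ext fun i j => (big i j).1.2
    have dE1 : E1.det = 1 := by
      rw [Matrix.det_of_upperTriangular (M := E1) fun i j hij => (big i j).2.1.1 hij,
        Fin.prod_univ_eight, hE1]
      simp
    have dE2 : E2.det = 1 := by
      rw [Matrix.det_of_lowerTriangular E2 (fun i j hij => (big i j).2.1.2.2 hij),
        Fin.prod_univ_eight, hE2]
      simp
    have dT : T.det = perPoly (Fin 3) ℂ := by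
      rw [Matrix.det_of_upperTriangular (M := T) fun i j hij => (big i j).2.1.2.1 hij,
        Fin.prod_univ_eight, hT]
      simp
    have h := congrArg Matrix.det h2
    rwa [← h1, Matrix.det_mul, Matrix.det_mul, dE1, dE2, dT, mul_one, mul_one] at h
  -- ### pins: a variable cell in every row (resp. column) whose variable is alone in its column (resp. row)
  have rowPin : ∀ i i' : Fin 8,
      (B i' (![1, 6, 4, 5, 0, 0, 0, 0] i)).coeff
        (Finsupp.single (![((2 : Fin 3), (0 : Fin 3)), (0,1), (0,2), (1,1), (1,0), (0,0), (1,2), (0,2)] i) 1) =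
      if i' = i then 1 else 0 := by
    intro i i'
    rw [hB]
    fin_cases i <;> fin_cases i' <;>
      simp [MvPolynomial.coeff_X, Finsupp.single_left_inj, coeff_one_single]
  have colPin : ∀ j j' : Fin 8,
      (B (![4, 0, 0, 0, 2, 2, 1, 1] j) j').coeff
        (Finsupp.single (![((1 : Fin 3), (0 : Fin 3)), (2,0), (2,1), (2,2), (0,2), (1,2), (0,1), (1,1)] j) 1) =
      if j' = j then 1 else 0 := by
    intro j j'
    rw [hB]
    fin_cases j <;> fin_cases j' <;>
      simp [MvPolynomial.coeff_X, Finsupp.single_left_inj, coeff_one_single]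
  -- ### apply the stub at `(n, m, B) = (3, 8, B8)`
  obtain ⟨a, ha, P, Q, B', hB', hz1, hz2, -, hcore⟩ :=
    hW 3 le_rfl (by rw [pdc3]; norm_num) 8 (by rw [pdc3]; norm_num) B hproj hdet
  have ha1 : a ≤ 1 := by have h := ha; rw [pdc3] at h; omega
  have hdetB' : B'.det = C ((P : Matrix (Fin 8) (Fin 8) ℂ).det * (Q : Matrix (Fin 8) (Fin 8) ℂ).det) *
      perPoly (Fin 3) ℂ := by
    rw [hB', det_map_C_mul_mul_map_C, hdet]
  have hPunit : IsUnit (P : Matrix (Fin 8) (Fin 8) ℂ).det :=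
    (Matrix.isUnit_iff_isUnit_det _).mp (Units.isUnit P)
  have hQunit : IsUnit (Q : Matrix (Fin 8) (Fin 8) ℂ).det :=
    (Matrix.isUnit_iff_isUnit_det _).mp (Units.isUnit Q)
  -- linear coefficients of the cells of `B' = P·B·Q`
  have lin_entry : ∀ (v : Fin 3 × Fin 3) (p q : Fin 8), (B' p q).coeff (Finsupp.single v 1) =
      ∑ k, (∑ i, (P : Matrix (Fin 8) (Fin 8) ℂ) p i * (B i k).coeff (Finsupp.single v 1)) *
        (Q : Matrix (Fin 8) (Fin 8) ℂ) k q := by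
    intro v p q
    have hc : ∀ (f : MvPolynomial (Fin 3 × Fin 3) ℂ) (c : ℂ),
        (f * C c).coeff (Finsupp.single v 1) = f.coeff (Finsupp.single v 1) * c := fun f c => by
      rw [mul_comm, MvPolynomial.coeff_C_mul, mul_comm]
    rw [hB']
    simp only [Matrix.mul_apply, Matrix.map_apply, MvPolynomial.coeff_sum, hc, MvPolynomial.coeff_C_mul]
  have lin_entry' : ∀ (v : Fin 3 × Fin 3) (p q : Fin 8), (B' p q).coeff (Finsupp.single v 1) =
      ∑ i, (P : Matrix (Fin 8) (Fin 8) ℂ) p i *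
        ∑ k, (B i k).coeff (Finsupp.single v 1) * (Q : Matrix (Fin 8) (Fin 8) ℂ) k q := by
    intro v p q
    rw [lin_entry]
    simp only [Finset.sum_mul, Finset.mul_sum, mul_assoc]
    rw [Finset.sum_comm]
  have coeff_C_single : ∀ (v : Fin 3 × Fin 3) (c : ℂ),
      (C c : MvPolynomial (Fin 3 × Fin 3) ℂ).coeff (Finsupp.single v 1) = 0 := fun v c => by
    rw [MvPolynomial.coeff_C, if_neg]
    exact Ne.symm (Finsupp.single_ne_zero.mpr one_ne_zero)
  obtain rfl | rfl : a = 0 ∨ a = 1 := by omega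
  · -- ### window `(0 | 7 | 1)`: the last row of `B'` is `(0, …, 0, d)`
    have hz : ∀ q : Fin 8, (q : ℕ) < 7 → B' (Fin.last 7) q = 0 := fun q hq =>
      hz2 (Fin.last 7) q (by rw [pdc3]; simp) (by rw [pdc3]; simpa using hq)
    have hcore' : (B'.submatrix Fin.castSucc Fin.castSucc).det = perPoly (Fin 3) ℂ := by
      rw [← Matrix.det_submatrix_equiv_self (finCongr pdc3), Matrix.submatrix_submatrix]
      convert hcore using 4 <;> (apply Fin.ext; simp)
    have hlap : B'.det = B' (Fin.last 7) (Fin.last 7) * perPoly (Fin 3) ℂ := by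
      rw [Matrix.det_succ_row B' (Fin.last 7), Fin.sum_univ_castSucc,
        Finset.sum_eq_zero (fun j _ => by
          rw [hz (Fin.castSucc j) (by rw [Fin.val_castSucc]; exact j.2), mul_zero, zero_mul]),
        zero_add, Fin.succAbove_last, hcore']
      simp
      norm_num
    have hcorner : B' (Fin.last 7) (Fin.last 7) =
        C ((P : Matrix (Fin 8) (Fin 8) ℂ).det * (Q : Matrix (Fin 8) (Fin 8) ℂ).det) :=
      mul_right_cancel₀ (perPoly_ne_zero (Fin 3) ℂ) (hlap.symm.trans hdetB')
    -- the linear parts of `r · B8`, `r` the last row of `P`, vanish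
    have hω : ∀ v : Fin 3 × Fin 3,
        (fun k => ∑ i, (P : Matrix (Fin 8) (Fin 8) ℂ) (Fin.last 7) i * (B i k).coeff (Finsupp.single v 1)) = 0 := by
      intro v
      set ω : Fin 8 → ℂ :=
        fun k => ∑ i, (P : Matrix (Fin 8) (Fin 8) ℂ) (Fin.last 7) i * (B i k).coeff (Finsupp.single v 1)
        with hω
      have h1 : ω ᵥ* (Q : Matrix (Fin 8) (Fin 8) ℂ) = 0 := by
        funext q
        change ∑ k, ω k * (Q : Matrix (Fin 8) (Fin 8) ℂ) k q = 0
        rw [← lin_entry v (Fin.last 7) q]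
        by_cases hq : (q : ℕ) < 7
        · rw [hz q hq, MvPolynomial.coeff_zero]
        · have hq' : q = Fin.last 7 := Fin.ext (by have := q.2; simp; omega)
          rw [hq', hcorner, coeff_C_single]
      have h2 : ω = ω ᵥ* (Q : Matrix (Fin 8) (Fin 8) ℂ) ᵥ* ((Q⁻¹ : GL (Fin 8) ℂ) : Matrix (Fin 8) (Fin 8) ℂ) := by
        rw [Matrix.vecMul_vecMul, Units.mul_inv, Matrix.vecMul_one]
      rw [h2, h1, Matrix.zero_vecMul]
    have hrow : ∀ i, (P : Matrix (Fin 8) (Fin 8) ℂ) (Fin.last 7) i = 0 := by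
      intro i
      have h := congrFun (hω (![((2 : Fin 3), (0 : Fin 3)), (0,1), (0,2), (1,1), (1,0), (0,0), (1,2), (0,2)] i))
        (![1, 6, 4, 5, 0, 0, 0, 0] i)
      simp only [rowPin i, mul_ite, mul_one, mul_zero, Finset.sum_ite_eq', Finset.mem_univ, if_true,
        Pi.zero_apply] at h
      exact h
    exact hPunit.ne_zero (Matrix.det_eq_zero_of_row_eq_zero (Fin.last 7) hrow)
  · -- ### window `(1 | 7 | 0)`: the first column of `B'` is `(d, 0, …, 0)ᵀ`
    have hz : ∀ p : Fin 8, 1 ≤ (p : ℕ) → B' p 0 = 0 := fun p hp => hz1 p 0 hp (by simp)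
    have hcore' : (B'.submatrix Fin.succ Fin.succ).det = perPoly (Fin 3) ℂ := by
      rw [← Matrix.det_submatrix_equiv_self (finCongr pdc3), Matrix.submatrix_submatrix]
      convert hcore using 4 <;> (apply Fin.ext; simp [add_comm])
    have hlap : B'.det = B' 0 0 * perPoly (Fin 3) ℂ := by
      rw [Matrix.det_succ_column_zero B', Fin.sum_univ_succ,
        Finset.sum_eq_zero (fun i _ => by
          rw [hz (Fin.succ i) (by rw [Fin.val_succ]; omega), mul_zero, zero_mul]),
        add_zero, Fin.succAbove_zero, hcore']
      simp
    have hcorner : B' 0 0 =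
        C ((P : Matrix (Fin 8) (Fin 8) ℂ).det * (Q : Matrix (Fin 8) (Fin 8) ℂ).det) :=
      mul_right_cancel₀ (perPoly_ne_zero (Fin 3) ℂ) (hlap.symm.trans hdetB')
    -- the linear parts of `B8 · s`, `s` the first column of `Q`, vanish
    have hω : ∀ v : Fin 3 × Fin 3,
        (fun i => ∑ k, (B i k).coeff (Finsupp.single v 1) * (Q : Matrix (Fin 8) (Fin 8) ℂ) k 0) = 0 := by
      intro v
      set ω : Fin 8 → ℂ :=
        fun i => ∑ k, (B i k).coeff (Finsupp.single v 1) * (Q : Matrix (Fin 8) (Fin 8) ℂ) k 0 with hω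
      have h1 : (P : Matrix (Fin 8) (Fin 8) ℂ) *ᵥ ω = 0 := by
        funext p
        change ∑ i, (P : Matrix (Fin 8) (Fin 8) ℂ) p i * ω i = 0
        rw [← lin_entry' v p 0]
        by_cases hp : 1 ≤ (p : ℕ)
        · rw [hz p hp, MvPolynomial.coeff_zero]
        · have hp' : p = 0 := Fin.ext (by simp at hp ⊢; omega)
          rw [hp', hcorner, coeff_C_single]
      have h2 : ω = ((P⁻¹ : GL (Fin 8) ℂ) : Matrix (Fin 8) (Fin 8) ℂ) *ᵥ ((P : Matrix (Fin 8) (Fin 8) ℂ) *ᵥ ω) := by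
        rw [Matrix.mulVec_mulVec, Units.inv_mul, Matrix.one_mulVec]
      rw [h2, h1, Matrix.mulVec_zero]
    have hcol : ∀ j, (Q : Matrix (Fin 8) (Fin 8) ℂ) j 0 = 0 := by
      intro j
      have h := congrFun (hω (![((1 : Fin 3), (0 : Fin 3)), (2,0), (2,1), (2,2), (0,2), (1,2), (0,1), (1,1)] j))
        (![4, 0, 0, 0, 2, 2, 1, 1] j)
      simp only [colPin j, ite_mul, one_mul, zero_mul, Finset.sum_ite_eq', Finset.mem_univ, if_true,
        Pi.zero_apply] at h
      exact h
    exact hQunit.ne_zero (Matrix.det_eq_zero_of_column_eq_zero 0 hcol)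

/-! ## §5 Small models below the guard (Lean: `Theorems/ProjLaplaceDoubling/Negative/SmallN.lean`, p152207)

* `pdc(per₂) = 3` while `dc(per₂) ≤ 2` (tree, `Theorems/PdcQpOfVp/Negative/AffineToProjectionBlowup.lean`):
  `affineDoubling_false_from_one : ¬ (∀ n ≥ 1, 2ⁿ−1 ≤ dc(per_n) → 2ⁿ⁺¹−1 ≤ dc(per_{n+1}))` — the affine analogue of the
  doubling pattern fails at `n = 1`, the projection analogue holds (`1 → 3 → 7`).
* `projOptimalUnique_false_at_two` : optimal projections of `per₂` are NOT unique modulo `GL₃(ℂ)² × permSymmetrySubst × ᵀ`: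
  Grenet₂ `[[0,X00,X10],[X11,-1,0],[X01,0,-1]]` (constant part `diag(0,-1,-1)`) versus the Schur lift
  `[[X00,0,X10],[X01,X11,0],[0,1,1]]` of the signed `2 × 2` determinant (constant part = one row); constant gauge maps a
  one-row matrix to an outer product (vanishing `2 × 2` minors), `constantCoeff ∘ linSubst γ = constantCoeff`,
  transposition transposes.  So the guard `n ≥ 3` of `ProjOptimalUnique` is load-bearing, and doubling `3 → 7` holds
  WITHOUT uniqueness at the lower level — uniqueness is not necessary for the numbers, only for this route's mechanism.

## §6 Open probes (status at the previous publication; §7 supersedes the first bullet)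

* PURIFIABILITY of the single-syzygy twist `gB₁ = gA(1+D)` (lead's addendum §7).  Sharpened here: with
  `B8' := [[gB₁~, X00·e_{u1}],[e_{v0}ᵀ, 1]]`, the `(1|7|0)` windows of `B8'` are excluded by the COLUMN-pin half of §3
  (the linear part of `B8'` has ℂ-independent columns), and a `(0|7|1)` window of `B8'` is EXACTLY a pair
  `P̃, Q₁ ∈ GL₇(ℂ)` with `P̃·gB₁·Q₁` a projection of determinant `per₃` (block computation: the core of any `(0|7|1)`
  window is `P̃ (M̃ − u f) Q₁ = P̃ gB₁ Q₁`).  So: `gB₁` purifiable ⇔ `B8'` is a window ⇔ (a second orbit, since the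
  coefficient-rank profile `(2⁵,1⁴)` of `gB₁` differs from Grenet's `(1⁶,2³)`) `¬ProjOptimalUniqueThree`.  Deciding it
  = a bilinear system `P·M_v = K_v·R` over guessed 0/1 supports `K_v`; generic-rank fingerprints of `gB₁`
  (`compute/fingerprint.py`) are available for pruning.  Undecided.
* Kit job `j024696` (queued at publication): bounded annealing search for 7 × 7 projections of per₃ with constants
  `±1, ±2` outside Grenet's orbit (orbit test = multiset rank signature).  Local pilot (160 DAG seeds): 11 hits, all with
  Grenet's profile and no constant cell used.
-/

/-! ## §7 DECIDED: `gB₁` is purifiable — an explicit second orbit of optimal projections of `per₃`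

```
K = P·gA·(1+D)·Q = !![X00, X00, X10, X20, 0,   1,   X22;
                      X21, X00, X10, X20, 1,   X01, X12;
                      X10, -1,  X21, 0,   X21, X11, X02;
                      X11, 0,   X01, -1,  X01, 1,   X22;
                      1,   0,   0,   0,   0,   0,   X02;
                      0,   0,   1,   0,   1,   0,   X12;
                      0,   0,   0,   0,   0,   1,   X22]          det K = per₃ ;  P, Q ∈ SL₇(ℤ) explicit.
```
Derivation (hand reduction + exact enumeration, refuter folder `compute/purify_gb1.py`, `k7_check.py`, `k7_factor.py`):
rank-1 variables ⇒ scaled indicator columns/rows; coordinate-span constraints on rows and columns; cell-level 0/1 and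
disjointness ⇒ all non-zero entries of `p₁,p₂,p₃` equal, `q⁴,q⁵,q⁶` indicator rows of disjoint sets, no type-C rows,
`supp p₀ ∩ supp p₁ = supp p₀ ∩ supp p₃ = ∅`, forced cancellation `α = −b²`; the remaining finite set-system problem has 8
solutions (1792 × 15712 configurations scanned), each verified symbolically; `b = 1` gives integer constants.  Lean files:
`Theorems/ProjOptimalUnique/Negative/PurifiedTwist.lean` (matrices, determinants via `gA·E₁·E₂ = T`, `K = P·(gA E)·Q`,
`P = L_P U_P W_P`, `Q = L_Q U_Q W_Q`; minors and private cells) and `Theorems/ProjectionRigidityProjOptimalUniqueThreeRefutation.lean`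
(monomial action `rm_symm` verbatim from the GrenetRigidity refutation, rank-≤-1 factorisation of the six one-row variables of
`gA`, pigeonhole `Fintype.exists_ne_map_eq_of_card_lt` on the five big variables of `K`, disjoint supports).  For THIS crux:
`C` is now a theorem for the wrong reason (false antecedent) — `refuted` is not the verdict for 16002; the planner's repair mode is
route-level (kill criterion #1: close, or restate uniqueness; any restatement "modulo polynomial gauge" needs a new packing idea).
-/

end Summit.ValiantsHypothesis.ValiantsHypothesis.Cruxes.ProjLaplaceDoubling.Disproof
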